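import Literature.MathematicalPhysics.QuantumFieldTheory.Balaban1983to89.B6Eq292MemberTorusV1L0
import Literature.MathematicalPhysics.QuantumFieldTheory.Balaban1983to89.B6Eq292MemberTorusV1L3
import Literature.MathematicalPhysics.QuantumFieldTheory.Balaban1983to89.B6Prop26KLevelSkeletonV2L0
import Literature.MathematicalPhysics.QuantumFieldTheory.Balaban1983to89.B6AgreeQaQV1Chart
import Literature.MathematicalPhysics.QuantumFieldTheory.Balaban1983to89.B6CubeCoeffSizesV1L0
import Literature.MathematicalPhysics.QuantumFieldTheory.Balaban1983to89.B6CubeCoeffSizesV1L3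
import Literature.MathematicalPhysics.QuantumFieldTheory.Balaban1983to89.B6CubeMoutV1
import Literature.MathematicalPhysics.QuantumFieldTheory.Balaban1983to89.B6CubeMoutV1L0
/-!
# `Balaban1983to89.B6CubeMoutV1L3` — RE-CENTRED-WINDOW TWIN (sub-row G-F3′-L0∕L3 of programme G-F3′-L0; UV3-NODE §26.3 (P2-L3); every odd `L ≥ 3`;
ruling of record `lit-balaban-r03/G-F3L0-PLAN.md` v1.5 §13 (B′), joints J9′–J11′, J14) of `B6CubeMoutV1L0`: the SAME declarations, names and
statements over p21's re-centred root `B6CubeWindowV1L3` (window corner `x0C = S_j·(qc − ℓ) = ctr − (2L−1)S_j/2` — the cube's central block is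
the middle block of its `2L`-block member torus, print p.238 «□ in the middle of □̃³ = T_□»; reach sub-window corner `x1C = x0C + (L−2)S_j`;
`PlacedC`; `eC`, `ρ`, `R ≥ 2L²`, `C = 9`, `M_c = 8S/3` UNCHANGED; the binder `(4 ≤ ℓ)` DROPPED).  J14: ONLY the window-dependent declarations are
re-declared here; every window-free declaration of the L0 twin and every `D`-free object of the lineage is consumed BY NAME.  No existing module is
touched; no fact is minted; standard axioms.  Unit `lit-balaban-p33` (gen 90), 2026-08-27.  THE TWIN'S DOCUMENTATION FOLLOWS VERBATIM (its
«x₀ = ctr − L·S_j/2» / «L ≥ 5» sentences describe the twin; here the anchor is `(2L−1)S_j/2` and L ≥ 3).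

statement-level skeleton of published theorems with citation tags; proofs where landed; nothing here is a claim about the Yang–Mills mass gap

# `Balaban1983to89.B6CubeMoutV1L0` — LEVEL-0 TWIN (programme G-F3′-L0, director-ym LINE №27 / UV3-NODE §24.5; plan `lit-balaban-r03/G-F3L0-PLAN.md`) of `B6CubeMoutV1`:
the same declarations, SAME NAMES AND STATEMENTS, for nested families WITH print's region `Λ₀ = T ∖ Ω₁` ADMITTED (structures
`B6MultiLevelBoxOperatorL0.Domains` / `B6MultiLevelTorusOperatorL0.TDomains`: levels `0, …, k`, the level-`0` block a single site, `Q′₀ = id`,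
finite weight `a₀` — print p.225 (2.14) «Σ_{j=0}^k … (Q′₀λ)(x) = λ(x), x ∈ Λ₀», p.229 «taking a sequence (2.1) … smallest possible domains B^j(Λ_j),
and considering the operator Δ_a defined by (2.19), (2.20) for this sequence»).  Every `D`-free object is the lineage's, consumed BY NAME; no existing
module is touched; no fact is minted.  Unit `lit-balaban-p33` (p33 gen 89; S-E entry twins named to p33 by the B6 owner r03 gen 36, ruling 2026-08-27T18:45:57Z; port tooling by r03 gen 36); B6 fold owner r03; referee ref-4.  THE TWIN'S DOCUMENTATION FOLLOWS
VERBATIM (its «levels 1 … k» / «Ω₁ = X» sentences describe the twin; here `j` runs from `0` and `Ω₁` may be a proper subset).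

# `Balaban1983to89.B6CubeMoutV1` — T. Bałaban, *Propagators and renormalization transformations for lattice gauge theories. II*,
# Commun. Math. Phys. **96** (1984) 223–250 [Balaban1984PropagatorsII], (2.92)–(2.93) p. 239, p. 247 (the supports of h_□, ζ_□ lie in □̃ — a paraphrase of p. 239's ζ_□ sentence, not a quotation; v1.2 docfix):
# THE OUTPUT LOCALISATION `hMout` OF `M_□h_□` OVER `□̃` FOR THE GENUINE MEMBER OF A CUBE ON THE GLOBAL TORUS — the local operator
# `M_□ = s(□)·τ_{−v}ε(Δ_□ + Q*a_□Q)ρτ_v` of `T_□` applied after the cut-off `h_□` has outputs on the blocks of `□̃ = QbigT □` (radius `7S/4`)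

statement-level skeleton of published theorems with citation tags; proofs where landed; nothing here is a claim about the Yang–Mills mass gap

PDF held: `paper:balaban1984-cmp96-propagators-rt-ii` (journal page = PDF page + 222): p. 239 [PDF 17] re-read (text layer): *"On this torus we define
operators R, Δ_a as in (2.17), (2.19), but only two scales are present now … G_□ = (Δ − ∂P_□∂* + Q*aQ)⁻¹ (2.90) … K_{□,□}(x) = Σ_{b∈st(x)}(∂h_□)(b)(∂A_μ)(b)
− (Δh_□)(x)A_μ(x) … (2.92)"*, p. 239 *"The function ζ_□ is of the same type as h_□, but it is equal to 1 on a cube containing □ … and it is equal to 0 outside a similar cube"*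
(v1.2 DOCFIX, ref-4 D-g67-1: v1/v1.1 carried «these functions have supports in □̃» in quotation marks attributed to p. 247 — that clause is OUR
PARAPHRASE, not print; Lean content unchanged); [Balaban1984PropagatorsI] (1.8), (1.11) p. 19 (a block average
`(Q_kA)(c)` only sees the fine bonds of `B(c₋) ∪ B(c₊)`).

CITATION HEADER (lean-in-tree rule) — WHAT IS REPRODUCED.  Phase-2 file of the `lit-balaban` typed skeleton, seat **p38 gen 28**; the B6 fold owner r03's
finding F5 (ii) (seat INBOX 2026-08-23T07:38Z/07:55Z: *"hMout : ∀ c, OutLoc (geomT D) (blkV1 hN D) (Ml c * mulOp (hB c)) (SbigT c) — needed because K's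
first term (h_□M_□ − M_□h_□) contains M_□h_□ un-sandwiched"*) — the displayed hypothesis (ii) of `…B6Prop26KLevelAssemblyV1.prop26_2136_kLevel_assembly`
(p358050).  SKELETON rows **B6.Eq2.92** × **B6.Eq2.93** × **B6.Prop2.6** (cells only; decls of record untouched).  IMPORTS BY NAME, restating nothing:
`…B6Eq292MemberTorusV1` (`NC`, `EC`, `cfC`, `c0C`, `zC`, **`hdec_cube`**: `h_□M_□ − M_□h_□ = (Σ_e c_e·E_e − c₀·) + z·(Nh_□ − h_□N)`), `…B6CubeWindowV1` (`Ml`, `tC`, `hch`, `hch_deep`, `trV_hB`), `…B6AgreeQaQV1Chart` (`toMatrix'_memberQaQ`,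
`blocks_of_bondAvgIter_single_ne_zero`, `sitesPerDir_zero_eq_mul`), `…B6AgreeLapV1Chart` (`eS/eB`, `DeepS`, `cB`, `val_eS`, `apply_eq_sum_toMatrix`),
`…B6Prop26KLevelSkeletonV2` (`SbigT`, `blkV1_mem_SbigT_of_hB_ne_zero`, `ST_subset_SbigT`), `…B6Partition118KLevelTorusCentral` (`Dch`, `cc`, `QbigT`,
`blkDeep_of_hF_ne_zero`), `…B6Partition118KLevelFineLip` (`Qbig`, `mem_Qbig`), `…B6TorusDepthDistance` (`min_le_torusSupNorm_sub`), `…B6TranslateTorusV1`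
(`TB`, `vch`, `outLoc_conj_chart`, `mulOp_eq_conj`), `…B5Eq118OneStroke` (`iterBlockOf`, `val_iterBlockOf`), `…B6Prop26Gluing` (`OutLoc`, `outLoc_mulOp_mul`).

THIS FILE (0 sorry; standard axioms; THEOREMS ONLY — no `def`, no `def … : Prop` fact, no hypothesis-shaped fact).
* §1 LABELS: `one_lt_sitesPerDir`, `label_bounds` (`q·L^{j′} ≤ x − x₀ < (q+1)·L^{j′}` for the member `j′`-block label `q` of a charted window site),
  `label_window` (a site of margin `r·L^{j′}` has `r ≤ q < N′_{j′} − r`), `val_tgt` (the label of `β₊` is `a`, `a + 1`, or wraps to `0`),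
  **`abs_sub_lt_of_common_block`**: two window sites whose member `j′`-blocks are end-blocks of ONE member `j′`-bond, one of them of margin `4L^{j′}`, have
  labels `< 2L^{j′}` apart (the member torus does not wrap there).
* §2 **`exists_of_memberQaQ_ne_zero`**: a nonzero entry `(Q*a_□Q)(b′, b′₁)` of the member's sandwich forces a member index bond `β′` of level `j′ ∈ {j, j+1}`
  whose averages see both `δ_{b′}` and `δ_{b′₁}` (the kernel `Σ_{Λ^c} + Σ_{Λ′}` of `toMatrix'_memberQaQ`).
* §3 **`blkOf_mem_Qbig_of_near_hF`**: a chart site within torus distance `S/2` of `supp h^F_□` has its block in `Qbig` (radius `7S/4`; `M_h ≥ 8`: carriers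
  are `S_k`-deep so the torus distance is the box distance, block side `≤ L^{j+1} ≤ S/8`).
* §4 THE CUBE: `torusSupNorm_le_of_memberQaQ` (`(Q*a_□Q)(e b, e b₁) ≠ 0`, `h^ch_□(b₁) ≠ 0 ⟹ |b₋ − b₁₋|_T ≤ S/2`), **`outLoc_QaQ_hch_chart`** (chart frame:
  `(s(□)•ε(Q*a_□Q)ρ)·(h^ch_□·)` has outputs on the blocks of `Qbig`), **`outLoc_NC_hB`** (global frame by `outLoc_conj_chart`: `N·(h_□·)` has outputs on
  `SbigT □`), and the capstone **`outLoc_Ml_hB`**: `OutLoc (geomT D) (blkV1 hN D) (Ml □ * mulOp (hB □)) (SbigT □)` — by parts through `hdec_cube`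
  (`M_□h_□ = h_□M_□ − [(Σ_e c_e·E_e − c₀·) + z·(Nh_□ − h_□N)]`: `supp h_□ ⊂ □⁺ ⊂ □̃`, `supp c_e, supp c₀ ⊂ □⁺` — entering as the
  hypotheses `hcfT`/`hc0T`, literally r03's displayed hypotheses (iii), which p38's `…B6CubeCoeffSizesV1L3.cfC_supp`/`c0C_supp` (v1.1, p358610)
  discharge — and `N·(h_□·)`).
* §5 (v1.1, APPEND-ONLY; `import …B6CubeCoeffSizesV1` added) **`outLoc_Ml_hB'`**: the same with `hcfT`/`hc0T` DISCHARGED inside by `cfC_supp`/`c0C_supp`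
  (both in the tree, b1b9615ce29b) — hypothesis (ii) as a closed `∀ c` under the regime `M_h = L^a ≥ 8`, `R ≥ 2L²`, `P′ ≥ 5`, placed cube.

HONEST SCOPE / DIVERGENCES. (i) Lattice units, `η = 1`; V1 global torus, chart frame of the cube as in `…B6CubeWindowV1` (`M_h = L^a ≥ 8`, `R ≥ 2L²`,
`P′_μ ≥ 5`, placed cube).  (ii) Print's `□̃` is the cube of (2.93) («2/3M»); the tree's `□̃ = QbigT □` is p21/p38's block set of radius `7S/4` — the set over
which r03's assembly localises `K`; this file proves the localisation for THAT set (in fact the outputs of `M_□h_□` lie within `S + S/4 + L^{j+1}` of the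
centre).  (iii) Pure bookkeeping of supports: no estimate of [6] is involved; the only inputs are the locality of block averages ((1.8)/(1.11) of
[Balaban1984PropagatorsI], r03's `blocks_of_bondAvgIter_single_ne_zero`) and the depth of `supp h_□` in the window (`hch_deep`).  Nothing on d = 4 or the
continuum; NOT summit progress.  Unit `lit-balaban-p38` (gen 28: v1 p359177 b629576cfa6b; v1.1 §5), 2026-08-23.
-/

noncomputable section

open scoped BigOperators
open Finset

namespace Literature.MathematicalPhysics.QuantumFieldTheory.Balaban1983to89.B6CubeMoutV1L3

open LatticeFieldCalculus (bondAvgIter)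
open B4ContourShift (supNorm abs_le_supNorm)
open B4Reflection242 (boxDom)
open B4TorusKernel.MultiPeriod (torusSupNorm torusSupNorm_le_supNorm)
open B6MultiLevelBoxOperator (N0 bigSide)
open B6MultiLevelTorusOperator (one_le_of_mem)
open B6MultiLevelTorusOperatorL0 (TDomains)
open B6Geom246MultiLevelBox (toR supNorm_eq_dist)
open B6Geom246MultiLevelBoxL0 (bset blkOf dist_toR_cen_le cen)
open B6Geom246MultiLevelTorus (torusSupNorm_neg)
open B6Geom246MultiLevelTorusL0 (geomT blkMap)
open B6Cover236MultiLevelBlocksL0 (cubes side ctr)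
open B6Eq238MultiLevelTorus (svec)
open B6Partition118KLevelFineL0 (hF dist_lt_of_hF_ne_zero lev_window_of_dist_lt_three_halves)
open B6Partition118KLevelFineLipL0 (Qbig mem_Qbig)
open B6Partition118KLevelTorusCentralL0 (Dch cc QbigT side_cc level_bounds blkDeep_of_hF_ne_zero)
open B6TorusDepthDistance (SiteDeep min_le_torusSupNorm_sub)
open B6CubeWindowV1 (one_le_bigSide_real)
open B5Eq118OneStroke (iterBlockOf val_iterBlockOf)
open Literature.MathematicalPhysics.QuantumFieldTheory.Balaban1983to89.B6CubeMoutV1 (one_lt_sitesPerDir label_bounds label_window val_tgt abs_sub_lt_of_common_block exists_of_memberQaQ_ne_zero)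
open Literature.MathematicalPhysics.QuantumFieldTheory.Balaban1983to89.B6CubeMoutV1L0 (blkOf_mem_Qbig_of_near_hF)

variable {d ℓ : ℕ}

/-! ## §§1–2 of the original (`one_lt_sitesPerDir`, `label_bounds`, `label_window`, `val_tgt`, `abs_sub_lt_of_common_block`,
`exists_of_memberQaQ_ne_zero`: two-scale member labels and kernels) are `D`-free and are opened BY NAME above -/

/-! ## §3  Chart geometry: a site within torus distance `S/2` of `supp h^F_□` has its block in `Qbig` -/

section Geometry

variable {Mh k R : ℕ} {P : Fin (d + 1) → ℕ} (D : TDomains d ℓ Mh k P R)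

end Geometry

/-! ## §4  The cube: `N·(h_□·)` and `M_□·(h_□·)` have outputs on `□̃ = SbigT □` -/

section Cube

open B6Ineq2133TwoScaleV1 (onFun)
open B6GlobalChartV1 (PV toBox toBox_apply)
open B6GlobalChartV1L0 (domT blkV1)
open B6SectAOperatorsV1 (BondIdx)
open B6Prop25TwoScaleCensus (TSIdx)
open B6AgreeLapV1Chart (cB eB eS DeepS mem_cB_W deepS_mono transplant_eB_eq apply_eq_sum_toMatrix)
open B6AgreeQaQV1Chart (blocks_of_bondAvgIter_single_ne_zero)
open B6Prop26ReachTransplant (restrictOp transplant transplant_apply restrictOp_apply chartBond)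
open B6Prop26Gluing (mulOp mulOp_apply OutLoc outLoc_mulOp_mul)
open B6TranslateTorusV1 (vch TB TB_mul_TB_neg mulOp_eq_conj)
open B6TranslateTorusV1L0 (outLoc_conj_chart)
open B6Prop26KLevelSkeletonV1L0 (hB ST)
open B6Prop26KLevelSkeletonV2L0 (SbigT mem_SbigT ST_subset_SbigT blkV1_mem_SbigT_of_hB_ne_zero)
open B6CubeWindowV1L3 (x0C PlacedC)
open B6CubeWindowV1L3 (tC tC_j hx0 hfit hch_deep Ml)
open B6CubeWindowV1L0 (sc wC hch hch_apply j0 j0_le_level trV_hB)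
open B6Eq292MemberTorusV1L3 (cfC c0C NC EC zC hdec_cube)

variable {hd : 1 ≤ d + 1} {hL : Odd (ℓ + 1) ∧ 1 < ℓ + 1} {a₀ a₁ : ℝ} {m K : ℕ} {Mh k R : ℕ} {P' : Fin (d + 1) → ℕ}
variable (hN : ∀ μ, N0 ℓ Mh k P' μ = (PV d ℓ m K hd hL).sitesPerDir 0) {D : TDomains d ℓ Mh k P' R} (hk : k ≤ m + K)
  (hMh1 : 1 ≤ Mh) (hP4 : ∀ μ, 4 ≤ P' μ) {a : ℕ} (hMha : Mh = (ℓ + 1) ^ a) (c : ↥(cubes D.toDomains)) (ha : a₀ ≤ a₁)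

include hMha in
/-- **A NONZERO ENTRY `(Q*a_□Q)(e b, e b₁)` WITH `h^ch_□(b₁) ≠ 0` PUTS `b₋` WITHIN `S/2` OF `b₁₋` ON THE TORUS** (`M_h ≥ 8`, `R ≥ 2L²`, window bond `b`):
the two fine bonds lie under one member index bond of level `j′ ≤ j₀ + 1` (§2), `supp h^ch_□` has margin `4L^{j₀+1}` (`hch_deep`), so the labels are
`< 2L^{j′} ≤ 2L^{j+1} ≤ S/4` apart (§1). [cite: Balaban1984PropagatorsI, (1.8), (1.11) p.19; Balaban1984PropagatorsII, (2.89)–(2.90) p.239, p.238 (□ ⊂ □̃³)] -/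
theorem torusSupNorm_le_of_memberQaQ (hM8 : 8 ≤ Mh) (hR2 : 2 * (ℓ + 1) ^ 2 ≤ R)
    (w : BondIdx (B6GlobalChartV1L0.domT hN D hk) → ℝ) (cf : ℝ) {b b₁ : PBond (PV d ℓ m K hd hL) 0}
    (hb : b.src ∈ DeepS (tC hN hk hMh1 hP4 c ha a (wC hN hk c w) cf) (x0C ℓ Mh k c.1) 0) (hb₁ : hch hN hMh1 hP4 c b₁ ≠ 0)
    (hK : LinearMap.toMatrix' (onFun (LinearMap.adjoint (tC hN hk hMh1 hP4 c ha a (wC hN hk c w) cf).D.Q ∘ₗ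
        (tC hN hk hMh1 hP4 c ha a (wC hN hk c w) cf).D.a ∘ₗ (tC hN hk hMh1 hP4 c ha a (wC hN hk c w) cf).D.Q))
        (eB (tC hN hk hMh1 hP4 c ha a (wC hN hk c w) cf) (x0C ℓ Mh k c.1) b)
        (eB (tC hN hk hMh1 hP4 c ha a (wC hN hk c w) cf) (x0C ℓ Mh k c.1) b₁) ≠ 0) :
    torusSupNorm (N0 ℓ Mh k P') ((toBox hN b.src).1 - (toBox hN b₁.src).1) ≤ (bigSide ℓ Mh c.1.1 : ℝ) / 2 := by
  obtain ⟨j', hj', β', hA, hA₁⟩ := exists_of_memberQaQ_ne_zero _ hK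
  have hj0 : (tC hN hk hMh1 hP4 c ha a (wC hN hk c w) cf).j = j0 hMh1 hP4 c := rfl
  have hj'le : j' ≤ j0 hMh1 hP4 c + 1 := by omega
  have hj't : j' ≤ (tC hN hk hMh1 hP4 c ha a (wC hN hk c w) cf).m + (tC hN hk hMh1 hP4 c ha a (wC hN hk c w) cf).K := by
    have := (tC hN hk hMh1 hP4 c ha a (wC hN hk c w) cf).hj
    omega
  -- `supp h^ch_□` has margin `4L^{j₀+1} ≥ 4L^{j′}`
  have hdeep₁ : b₁.src ∈ DeepS (tC hN hk hMh1 hP4 c ha a (wC hN hk c w) cf) (x0C ℓ Mh k c.1) (4 * (ℓ + 1) ^ j') :=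
    deepS_mono (Nat.mul_le_mul_left 4 (Nat.pow_le_pow_right (by omega) hj'le)) (hch_deep hN hMh1 hP4 hMha c ha hM8 hR2 hb₁)
  -- the member blocks of `e b₋`, `e b₁₋` are end-blocks of `β′`
  have hBy := (blocks_of_bondAvgIter_single_ne_zero (P := (tC hN hk hMh1 hP4 c ha a (wC hN hk c w) cf).P) hj't hA).1
  have hB₁ := (blocks_of_bondAvgIter_single_ne_zero (P := (tC hN hk hMh1 hP4 c ha a (wC hN hk c w) cf).P) hj't hA₁).1
  have hco : ∀ μ, |((b.src μ).val : ℤ) - (b₁.src μ).val| < 2 * (((ℓ + 1) ^ j' : ℕ) : ℤ) :=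
    fun μ => abs_sub_lt_of_common_block hj't hb hdeep₁ hBy hB₁ μ
  -- torus distance ≤ label distance `< 2L^{j′} ≤ 2L^{j+1} ≤ S/4`
  have hN1 : ∀ i, 1 ≤ N0 ℓ Mh k P' i := one_le_of_mem (toBox hN b.src).2
  refine le_trans (torusSupNorm_le_supNorm hN1 _) ?_
  have hjc : j' ≤ c.1.1 + 1 := le_trans hj'le (by have := (j0_le_level hMh1 hP4 c hL hR2).1; omega)
  have hl1 : (1 : ℝ) ≤ (ℓ : ℝ) + 1 := by have : (0 : ℝ) ≤ ℓ := Nat.cast_nonneg _; linarith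
  have hpow : ((ℓ : ℝ) + 1) ^ j' ≤ ((ℓ : ℝ) + 1) ^ (c.1.1 + 1) := pow_le_pow_right₀ hl1 hjc
  have hM : (8 : ℝ) ≤ Mh := by exact_mod_cast hM8
  have eS : (bigSide ℓ Mh c.1.1 : ℝ) = (Mh : ℝ) * ((ℓ : ℝ) + 1) ^ (c.1.1 + 1) := by unfold bigSide; push_cast; ring
  have hp0 : (0 : ℝ) ≤ ((ℓ : ℝ) + 1) ^ j' := by positivity
  refine Finset.sup'_le _ _ fun μ _ => ?_
  have hμ : (((|((toBox hN b.src).1 - (toBox hN b₁.src).1) μ| : ℤ)) : ℝ) ≤ 2 * ((ℓ : ℝ) + 1) ^ j' := by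
    have h := (hco μ).le
    have : (((|((b.src μ).val : ℤ) - (b₁.src μ).val| : ℤ)) : ℝ) ≤ (((2 * (((ℓ + 1) ^ j' : ℕ) : ℤ)) : ℤ) : ℝ) := by exact_mod_cast h
    simpa using this
  rw [eS]
  nlinarith [mul_le_mul_of_nonneg_right hM (le_trans hp0 hpow)]

include hMha in
/-- **`(s(□)•ε(Q*a_□Q)ρ)·(h^ch_□·)` HAS OUTPUTS ON THE BLOCKS OF `Qbig` (CHART FRAME)**: a nonzero output at a window bond `b` needs a window bond `b₁`
with `h^ch_□(b₁) ≠ 0` and `(Q*a_□Q)(e b, e b₁) ≠ 0`, whence `|b₋ − b₁₋|_T ≤ S/2` and the block of `b₋` is in `Qbig` (§3); off the window `ε = 0`.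
[cite: Balaban1984PropagatorsII, (2.92)–(2.93) p.239 (supports of h_□, ζ_□ in □̃ — our paraphrase of p.239 «equal to 1 on a cube containing □ … equal to 0 outside a similar cube», not a printed sentence), p.247; Balaban1984PropagatorsI, (1.8), (1.11) p.19] -/
theorem outLoc_QaQ_hch_chart (hM8 : 8 ≤ Mh) (hR2 : 2 * (ℓ + 1) ^ 2 ≤ R) (hP5 : ∀ μ, 5 ≤ P' μ) (hpl : PlacedC ℓ k P' c.1)
    (w : BondIdx (B6GlobalChartV1L0.domT hN D hk) → ℝ) (cf : ℝ) :
    OutLoc (g := geomT (D.chart (svec ℓ k c.1.1 c.1.2))) (blkV1 hN (D.chart (svec ℓ k c.1.1 c.1.2)))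
      ((sc hMh1 hP4 c cf • transplant (cB (tC hN hk hMh1 hP4 c ha a (wC hN hk c w) cf) (x0C ℓ Mh k c.1) (hx0 hpl) (hfit hN hMh1 hP4 hMha c ha hpl)).W
          (eB (tC hN hk hMh1 hP4 c ha a (wC hN hk c w) cf) (x0C ℓ Mh k c.1))
          (onFun (LinearMap.adjoint (tC hN hk hMh1 hP4 c ha a (wC hN hk c w) cf).D.Q ∘ₗ (tC hN hk hMh1 hP4 c ha a (wC hN hk c w) cf).D.a ∘ₗ
            (tC hN hk hMh1 hP4 c ha a (wC hN hk c w) cf).D.Q))) *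
        mulOp (hch hN hMh1 hP4 c))
      {y | y ∈ Qbig (Dch D c) (cc D hMh1 hP4 c)} := by
  have hR : 2 * (ℓ + 1) ≤ R := le_trans (by nlinarith : 2 * (ℓ + 1) ≤ 2 * (ℓ + 1) ^ 2) hR2
  intro v b hb
  rw [Module.End.mul_apply, LinearMap.smul_apply, Pi.smul_apply, smul_eq_mul, transplant_apply]
  by_cases hW : b ∈ (cB (tC hN hk hMh1 hP4 c ha a (wC hN hk c w) cf) (x0C ℓ Mh k c.1) (hx0 hpl) (hfit hN hMh1 hP4 hMha c ha hpl)).W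
  · rw [if_pos hW]
    refine mul_eq_zero_of_right _ ?_
    rw [apply_eq_sum_toMatrix]
    refine Finset.sum_eq_zero fun b'₁ _ => ?_
    by_contra hne
    obtain ⟨hK, hρ⟩ := mul_ne_zero_iff.1 hne
    rw [restrictOp_apply] at hρ
    obtain ⟨b₁, hb₁W, hg⟩ := Finset.exists_ne_zero_of_sum_ne_zero hρ
    rw [Finset.mem_filter] at hb₁W
    rw [mulOp_apply] at hg
    have hch₁ : hch hN hMh1 hP4 c b₁ ≠ 0 := (mul_ne_zero_iff.1 hg).1
    rw [← hb₁W.2] at hK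
    have hdist := torusSupNorm_le_of_memberQaQ hN hk hMh1 hP4 hMha c ha hM8 hR2 w cf (mem_cB_W.1 hW) hch₁ hK
    rw [hch_apply] at hch₁
    exact hb (blkOf_mem_Qbig_of_near_hF D hM8 hR hP5 hP4 c hch₁ hdist)
  · rw [if_neg hW, mul_zero]

/-- `OutLoc` is additive. [folklore] -/
private theorem outLoc_add' {g : B6.Geometry} {X : Type} (blk : X → g.Site) {T T' : Module.End ℝ (X → ℝ)} {S : Set g.Site}
    (h : OutLoc blk T S) (h' : OutLoc blk T' S) : OutLoc blk (T + T') S := by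
  intro v x hx
  rw [LinearMap.add_apply, Pi.add_apply, h v x hx, h' v x hx, add_zero]

/-- `OutLoc` passes to differences. [folklore] -/
private theorem outLoc_sub' {g : B6.Geometry} {X : Type} (blk : X → g.Site) {T T' : Module.End ℝ (X → ℝ)} {S : Set g.Site}
    (h : OutLoc blk T S) (h' : OutLoc blk T' S) : OutLoc blk (T - T') S := by
  intro v x hx
  rw [LinearMap.sub_apply, Pi.sub_apply, h v x hx, h' v x hx, sub_zero]

/-- `OutLoc` passes to finite sums. [folklore] -/
private theorem outLoc_sum' {g : B6.Geometry} {X : Type} (blk : X → g.Site) {ι : Type} (s : Finset ι) {T : ι → Module.End ℝ (X → ℝ)}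
    {S : Set g.Site} (h : ∀ i ∈ s, OutLoc blk (T i) S) : OutLoc blk (∑ i ∈ s, T i) S := by
  classical
  induction s using Finset.induction_on with
  | empty => intro v x _; simp
  | insert i s hi ih =>
    rw [Finset.sum_insert hi]
    exact outLoc_add' blk (h i (Finset.mem_insert_self i s)) (ih fun i' hi' => h i' (Finset.mem_insert_of_mem hi'))

/-- a further left multiplication keeps `OutLoc`. [folklore] -/
private theorem outLoc_mulOp_left' {g : B6.Geometry} {X : Type} (blk : X → g.Site) (z : X → ℝ) {T : Module.End ℝ (X → ℝ)} {S : Set g.Site}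
    (h : OutLoc blk T S) : OutLoc blk (mulOp z * T) S := by
  intro v x hx
  rw [Module.End.mul_apply, mulOp_apply, h v x hx, mul_zero]

include hMha in
/-- **`N·(h_□·)` HAS OUTPUTS ON `□̃ = SbigT □`** (global frame): `N = τ_{−v}(s(□)•ε(Q*a_□Q)ρ)τ_v`, `h_□· = τ_{−v}(h^ch_□·)τ_v`, so `N·(h_□·)` is the conjugate
of the chart-frame operator of `outLoc_QaQ_hch_chart`, and `SbigT □` is the block-map image of `Qbig` (`outLoc_conj_chart`).
[cite: Balaban1984PropagatorsII, (2.92)–(2.93) p.239, p.247, dictionary (charts)] -/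
theorem outLoc_NC_hB (hM8 : 8 ≤ Mh) (hR2 : 2 * (ℓ + 1) ^ 2 ≤ R) (hP5 : ∀ μ, 5 ≤ P' μ) (hpl : PlacedC ℓ k P' c.1)
    (w : BondIdx (B6GlobalChartV1L0.domT hN D hk) → ℝ) (cf : ℝ) :
    OutLoc (g := geomT D) (blkV1 hN D) (NC hN hk hMh1 hP4 hMha c ha hpl w cf * mulOp (hB hN D c)) (SbigT D hMh1 hP4 c) := by
  have hP : ∀ μ, 1 ≤ P' μ := fun μ => le_trans (by norm_num) (hP4 μ)
  -- `h_□· = τ_{−v}(h^ch_□·)τ_v`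
  have hh : TB (-vch (ℓ := ℓ) (m := m) (K := K) (hd := hd) (hL := hL) Mh k (svec ℓ k c.1.1 c.1.2)) * mulOp (hch hN hMh1 hP4 c) *
      TB (vch Mh k (svec ℓ k c.1.1 c.1.2)) = mulOp (hB hN D c) := by
    rw [← trV_hB hN hMh1 hP4 c, ← mulOp_eq_conj]
  have e : NC hN hk hMh1 hP4 hMha c ha hpl w cf * mulOp (hB hN D c) =
      TB (-vch (ℓ := ℓ) (m := m) (K := K) (hd := hd) (hL := hL) Mh k (svec ℓ k c.1.1 c.1.2)) *
        ((sc hMh1 hP4 c cf • transplant (cB (tC hN hk hMh1 hP4 c ha a (wC hN hk c w) cf) (x0C ℓ Mh k c.1) (hx0 hpl) (hfit hN hMh1 hP4 hMha c ha hpl)).W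
            (eB (tC hN hk hMh1 hP4 c ha a (wC hN hk c w) cf) (x0C ℓ Mh k c.1))
            (onFun (LinearMap.adjoint (tC hN hk hMh1 hP4 c ha a (wC hN hk c w) cf).D.Q ∘ₗ (tC hN hk hMh1 hP4 c ha a (wC hN hk c w) cf).D.a ∘ₗ
              (tC hN hk hMh1 hP4 c ha a (wC hN hk c w) cf).D.Q))) *
          mulOp (hch hN hMh1 hP4 c)) *
        TB (vch Mh k (svec ℓ k c.1.1 c.1.2)) := by
    rw [← hh, NC, ← transplant_eB_eq]
    simp only [mul_assoc]
    rw [← mul_assoc (TB (vch Mh k (svec ℓ k c.1.1 c.1.2))) (TB (-vch Mh k (svec ℓ k c.1.1 c.1.2))), TB_mul_TB_neg, one_mul]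
  rw [e]
  have key := outLoc_conj_chart hN D hMh1 hP (svec ℓ k c.1.1 c.1.2) (outLoc_QaQ_hch_chart hN hk hMh1 hP4 hMha c ha hM8 hR2 hP5 hpl w cf)
  -- the block-map image of `Qbig` is `SbigT □`
  intro v x hx
  refine key v x fun hx' => hx ?_
  obtain ⟨x', hx'Q, hx'e⟩ := hx'
  have hmem : blkMap D (svec ℓ k c.1.1 c.1.2) x' ∈ QbigT D hMh1 hP4 c := Finset.mem_image_of_mem _ hx'Q
  rw [hx'e] at hmem
  exact (mem_SbigT D hMh1 hP4 c _).2 hmem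

include hMha in
/-- **`hMout` FOR THE GENUINE MEMBER OF THE CUBE**: `OutLoc (geomT D) (blkV1 hN D) (Ml □ * mulOp (hB □)) (SbigT □)` — `M_□h_□ = h_□M_□ − (h_□M_□ − M_□h_□)`
with `hdec_cube`: `h_□M_□` and `h_□N` are cut off by `supp h_□ ⊂ □⁺ ⊂ □̃`, the line-1 pieces by `supp c_e, supp c₀ ⊂ □⁺` (the hypotheses `hcfT`, `hc0T`: r03's
displayed hypotheses (iii), discharged by `…B6CubeCoeffSizesV1L3.cfC_supp`/`c0C_supp`), and `z·N·(h_□·)` by `outLoc_NC_hB` — the displayed hypothesis (ii)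
of r03's `prop26_2136_kLevel_assembly` (`M_h = L^a ≥ 8`, `R ≥ 2L²`, `P′ ≥ 5`, placed cube).
[cite: Balaban1984PropagatorsII, (2.92)–(2.93) p.239 (supports of h_□, ζ_□ in □̃ — our paraphrase of p.239 «equal to 1 on a cube containing □ … equal to 0 outside a similar cube», not a printed sentence), (2.90)–(2.91) p.239, p.247] -/
theorem outLoc_Ml_hB (hM8 : 8 ≤ Mh) (hR2 : 2 * (ℓ + 1) ^ 2 ≤ R) (hP5 : ∀ μ, 5 ≤ P' μ) (hpl : PlacedC ℓ k P' c.1)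
    (w : BondIdx (B6GlobalChartV1L0.domT hN D hk) → ℝ) (cf : ℝ)
    (hcfT : ∀ (e : Fin (d + 1) × Bool) (x : PBond (PV d ℓ m K hd hL) 0),
      cfC hN hk hMh1 hP4 hMha c ha hpl w cf e x ≠ 0 → blkV1 hN D x ∈ ST D hMh1 hP4 c)
    (hc0T : ∀ x : PBond (PV d ℓ m K hd hL) 0, c0C hN hk hMh1 hP4 hMha c ha hpl w cf x ≠ 0 → blkV1 hN D x ∈ ST D hMh1 hP4 c) :
    OutLoc (g := geomT D) (blkV1 hN D) (Ml hN hk hMh1 hP4 hMha c ha hpl w cf * mulOp (hB hN D c)) (SbigT D hMh1 hP4 c) := by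
  have hMh : 2 ≤ Mh := le_trans (by norm_num) hM8
  have hR : 2 * (ℓ + 1) ≤ R := le_trans (by nlinarith : 2 * (ℓ + 1) ≤ 2 * (ℓ + 1) ^ 2) hR2
  have hBsupp : ∀ x, hB hN D c x ≠ 0 → blkV1 hN D x ∈ SbigT D hMh1 hP4 c :=
    fun x hx => blkV1_mem_SbigT_of_hB_ne_zero hN D hMh hR hP4 c hx
  have e : Ml hN hk hMh1 hP4 hMha c ha hpl w cf * mulOp (hB hN D c) =
      mulOp (hB hN D c) * Ml hN hk hMh1 hP4 hMha c ha hpl w cf -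
        (mulOp (hB hN D c) * Ml hN hk hMh1 hP4 hMha c ha hpl w cf - Ml hN hk hMh1 hP4 hMha c ha hpl w cf * mulOp (hB hN D c)) :=
    (sub_sub_cancel _ _).symm
  rw [e, hdec_cube hN hk hMh1 hP4 hMha c ha hM8 hR2 hpl w cf]
  refine outLoc_sub' _ (outLoc_mulOp_mul _ hBsupp _) (outLoc_add' _ (outLoc_sub' _ ?_ ?_) (outLoc_sum' _ _ fun _ _ => ?_))
  · exact outLoc_sum' _ _ fun e _ =>
      outLoc_mulOp_mul _ (fun x hx => ST_subset_SbigT D hMh1 hP4 c (hcfT e x hx)) _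
  · intro v x hx
    rw [mulOp_apply]
    have h0 : c0C hN hk hMh1 hP4 hMha c ha hpl w cf x = 0 := by
      by_contra hne
      exact hx (ST_subset_SbigT D hMh1 hP4 c (hc0T x hne))
    rw [h0, zero_mul]
  · exact outLoc_mulOp_left' _ _ (outLoc_sub' _ (outLoc_NC_hB hN hk hMh1 hP4 hMha c ha hM8 hR2 hP5 hpl w cf) (outLoc_mulOp_mul _ hBsupp _))

end Cube

/-! ## §5  (v1.1) `hMout` with the line-1 supports discharged -/

section Discharged

open B6GlobalChartV1 (PV)
open B6GlobalChartV1L0 (domT blkV1)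
open B6SectAOperatorsV1 (BondIdx)
open B6Prop26Gluing (mulOp OutLoc)
open B6Prop26KLevelSkeletonV1L0 (hB)
open B6Prop26KLevelSkeletonV2L0 (SbigT)
open B6CubeWindowV1L3 (PlacedC)
open B6CubeWindowV1L3 (Ml)
open B6CubeCoeffSizesV1L3 (cfC_supp c0C_supp)

variable {hd : 1 ≤ d + 1} {hL : Odd (ℓ + 1) ∧ 1 < ℓ + 1} {a₀ a₁ : ℝ} {m K : ℕ} {Mh k R : ℕ} {P' : Fin (d + 1) → ℕ}
variable (hN : ∀ μ, N0 ℓ Mh k P' μ = (PV d ℓ m K hd hL).sitesPerDir 0) {D : TDomains d ℓ Mh k P' R} (hk : k ≤ m + K)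
  (hMh1 : 1 ≤ Mh) (hP4 : ∀ μ, 4 ≤ P' μ) {a : ℕ} (hMha : Mh = (ℓ + 1) ^ a) (c : ↥(cubes D.toDomains)) (ha : a₀ ≤ a₁)

/-- **`hMout` FOR THE GENUINE MEMBER OF THE CUBE, CLOSED FORM**: `OutLoc (geomT D) (blkV1 hN D) (Ml □ * mulOp (hB □)) (SbigT □)` under `M_h = L^a ≥ 8`,
`R ≥ 2L²`, `P′ ≥ 5`, placed cube — `outLoc_Ml_hB` with the supports of `c_e`, `c₀` supplied by `…B6CubeCoeffSizesV1L3.cfC_supp`/`c0C_supp`; the displayed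
hypothesis (ii) of r03's `prop26_2136_kLevel_assembly` by name. [cite: Balaban1984PropagatorsII, (2.92)–(2.93) p.239 (supports of h_□, ζ_□ in □̃ — our paraphrase of p.239 «equal to 1 on a cube containing □ … equal to 0 outside a similar cube», not a printed sentence), (2.90)–(2.91) p.239, p.247] -/
theorem outLoc_Ml_hB' (hM8 : 8 ≤ Mh) (hR2 : 2 * (ℓ + 1) ^ 2 ≤ R) (hP5 : ∀ μ, 5 ≤ P' μ) (hpl : PlacedC ℓ k P' c.1)
    (w : BondIdx (B6GlobalChartV1L0.domT hN D hk) → ℝ) (cf : ℝ) :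
    OutLoc (g := geomT D) (blkV1 hN D) (Ml hN hk hMh1 hP4 hMha c ha hpl w cf * mulOp (hB hN D c)) (SbigT D hMh1 hP4 c) :=
  outLoc_Ml_hB hN hk hMh1 hP4 hMha c ha hM8 hR2 hP5 hpl w cf
    (fun e x hx => cfC_supp hN hk hMh1 hP4 hMha c ha hM8 hR2 hP5 hpl w cf e x hx)
    (fun x hx => c0C_supp hN hk hMh1 hP4 hMha c ha hM8 hR2 hP5 hpl w cf x hx)

end Discharged

end Literature.MathematicalPhysics.QuantumFieldTheory.Balaban1983to89.B6CubeMoutV1L3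
end
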